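import Summits.BirchSwinnertonDyer.BirchSwinnertonDyer.Theses.AdditiveBranchIMC
import Summits.BirchSwinnertonDyer.BirchSwinnertonDyer.Theorems.SchneiderFreeSocketsV2
import Summits.BirchSwinnertonDyer.BirchSwinnertonDyer.Theorems.SchneiderFreeUpperSockets
import Summits.BirchSwinnertonDyer.Rank1Residual.Additive.X4RankZeroCoveredLocusNoLemma20
import Literature.NumberTheory.EllipticCurves.Rank1Residual.Typed.JointLower
import Literature.NumberTheory.EllipticCurves.NonvanishingTwistsPrescribedRamificationSplit
import Literature.NumberTheory.EllipticCurves.NonvanishingTwistsPrescribedRamificationSimpleZero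
import Literature.NumberTheory.EllipticCurves.NonvanishingTwistsHoffsteinLuo
import Literature.NumberTheory.EllipticCurves.Wuthrich2014.SurjectiveDivisibilityCyclotomicPrimeHalf
import Literature.NumberTheory.EllipticCurves.Skinner2016.RankZeroPPart
import Literature.NumberTheory.EllipticCurves.BSDQuadraticDescent
import Literature.NumberTheory.EllipticCurves.BSDRootNumber
import Literature.NumberTheory.EllipticCurves.GrossZagierRationalPoint
import Literature.NumberTheory.EllipticCurves.Tamagawa
import Literature.NumberTheory.EllipticCurves.Hsieh2014.AnticyclotomicPAdicLFunctionRamifiedSteinberg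
import Literature.NumberTheory.EllipticCurves.LiuZhangZhang2018.PAdicWaldspurgerEllipticCurveAdditiveRamifiedSteinberg
import Literature.NumberTheory.EllipticCurves.CaiShuTian2014.ExplicitGrossZagier
import Literature.NumberTheory.EllipticCurves.CaiShuTian2014.ExplicitGrossZagierRingClass
import Literature.NumberTheory.EllipticCurves.Voight2007.RingClassGenusField
import Literature.NumberTheory.EllipticCurves.ManinConstantSemistablePrimewise
import Literature.NumberTheory.EllipticCurves.LeadingTerm
import Summits.BirchSwinnertonDyer.BirchSwinnertonDyer.Theorems.SchneiderFreeAdditiveX3BranchIMCRebaseHeight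
import Literature.NumberTheory.EllipticCurves.Gross2004.RationalCharacterLSeries
import Literature.NumberTheory.EllipticCurves.BSDQuadraticDescentShaOddPartGeneralProofs
import Literature.NumberTheory.EllipticCurves.BSDQuadraticDescentTorsionOddPartProofs
import HarnessLib
import Summits.BirchSwinnertonDyer.BirchSwinnertonDyer.Theorems.SchneiderFreeUpperSocketsSplit
import Literature.NumberTheory.EllipticCurves.MatarNekovar2019.ShaStructureIrreducible
import Literature.NumberTheory.EllipticCurves.ManinConstantQuadraticTwistIstarProofs
import Summits.BirchSwinnertonDyer.BirchSwinnertonDyer.Theorems.AdditiveBranchIMCGordTwoRankOneHeegnerKolyvaginIstarDoors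
import Summits.BirchSwinnertonDyer.BirchSwinnertonDyer.Theorems.AdditiveKolyvaginRoadManinFrameResidueProperRTameTwistPotGood
import Literature.NumberTheory.EllipticCurves.KolyvaginShaIndexBound

/-!
# Line `twist_unit_road_mult` (v2) — crux `MultLower` (item stmt-BirchSwinnertonDyer-19359, route
# `AdditiveBranchIMC` = K1), planner pen bsd-addord-plan gen 37, 2026-08-28 — the (M) TWIN of
# `GordTwoRankZeroOffCaseOne/Lines/twist_unit_road.lean`

A SECOND registered line on the crux, beside `tame_roads_mult` (v4, LEAD cruxlead-19357's (M) twin). It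
keeps the tame roads' FIELD 1 (a Heegner field `K` with ONE ramified Wan prime `q ∥ N_E`, `p` inert, the
twist `Wd = E^{(d_K)}_min` with `r_an(E) + r_an(Wd) = 1`, and the JOINT LOWER half of the pair) and, in
analytic rank `0`, REPLACES fields 2–3 (the `p`-ramified Kolyvagin field `K″`, the genus Heegner system,
the non-printed `p`-exact GENUS Kolyvagin bound U-b(M) and the Skinner 2016 partner) by the programme's
TWIST-UNIT LEVER (`SchneiderFree.Upper.missingUpperBoundAt_of_jointUpper_of_twistUnit`; the `p = 3` road
`RamifiedHeegnerPair…LeafRankOneUpperAtThreeTwistUnit` §2–§3):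

* UPPER(`Wd`) for the rank-one potentially multiplicative twist ⟸ a `p`-SPLIT strict Heegner field
  `K‴ = ℚ(√d)` for `N_{Wd}` whose rank-zero partner `B = Wd^{(d)}_min` has `ord_p #Ш_an(B) ≤ 0`
  (`TwistUnitSupplyDatum Wd p`), by PRINT BY NAME (v2: this port is the cell's tree theorem, see below):
  Gross–Zagier ∀, Kolyvagin ∀, GZK, Version L, GZ I.(7.3), Matar–Nekovář 2019 Thm 0.7 (irreducible form;
  `ρ̄` onto on the sub-row; strict Heegner; `d ∉ {−3,−4}`), Cassels, and Manin at `p` (Kodaira `I_n*`,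
  `n ≥ 1`, at the potentially multiplicative prime: the tree theorem
  `not_dvd_maninConstant_of_kodairaSymbolAt_eq_Istar`, transported along a prime-to-`p` isogeny) — NO
  lower bound for the partner (`0 ≤ ord_p #Ш(B)` is free).
* In analytic rank `1` nothing changes (the twist `Wd` has rank `0` and its upper half is the TREE theorem
  `AdditivePotMult.ClassX4M.missingUpperBoundAt_rankZero_of_surj_noL20`, as in `tame_roads_mult`).
* The line's ONE non-printed input is the SUPPLY `stub_twistUnitSupplyM` (every rank-one (M) curve with
  `ρ̄` onto, `p ≥ 5`, has a twist-unit datum): Ono–Skinner 1998 Cor. 2/4 give it for `ℓ` outside an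
  effectively determinable finite set, but their (L1)–(L2) (`ℓ ∤ 4N`, `ℓ > 2(k+2)`) EXCLUDE `ℓ = p ∣ N_{Wd}`
  — not in print on these rows; per pair a finite exact certificate.

So the crux closes on the sub-row modulo `PrintedFactsTUM ∧ stub_twistUnitSupplyM ∧ stub_tameJointLowerM`
(the latter shared verbatim with `tame_roads_mult`). BSD is not proved by any of this; nothing is asserted.

v2 (same day, 19:5xZ) — THE PRINT PORT IS ALREADY IN THE TREE. v1's `stub_upperOfTwistUnitM` is DISCHARGED
here, sorry-free, by the cell's Part 23b §15 (lane k1-c3x gen 6, crux 19358)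
`AdditiveBranchIMCGordTwoRankOne.HeegnerKolyvagin.missingUpperBoundAt_rankOne_istar_of_twistShaAnUnit` (UPPER(E,p)
at an additive prime of Kodaira type `Iₙ*`, every odd `p`, `ρ̄` onto, `p ∤ ∏c`, from PUB = Gross–Zagier ∀,
Kolyvagin ∀, Kolyvagin 1990 Thm A / McCallum 1991 §1 (`Kolyvagin1990_padicValNat_card_sha_le`, `p`-EXACT, strict
Heegner field, `p² ∣ N` allowed), GZK, Version L, `exists_isNewformOf`, Mazur / Abbes–Ullmo / Česnavičius — and ONE
Heegner twist with `L ≠ 0` and `ord_p #Ш_an ≤ 0`), with type `Iₙ*` at the potentially multiplicative prime by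
`ManinFrameResidueProperRTameTwist.exists_kodairaSymbolAt_eq_Istar_of_addv_of_padicValRat_j_neg` (additive ∧
`v_p(j) < 0`, Silverman ATAEC V.5.3 + IV.9.4). Accordingly `PrintedFactsTUM` gains the LAST conjunct
`∀ N W K, Kolyvagin1990_padicValNat_card_sha_le N W K`, the datum drops `Odd d`, `d < −4`, and the line's own open
content is EXACTLY ONE statement beyond the shared field 1: the SUPPLY `stub_twistUnitSupplyM`.

Registered stubs (5): `stub_residualM` [XL; verbatim the sibling line's], `stub_printedFactsTUM` [cite-only],
`stub_fieldSupplyTUM` [M; FIELD 1 only = the first clauses of `TameRoadsMult.stub_fieldSupplyM`],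
`stub_tameJointLowerM` [XL; verbatim the sibling line's], `stub_twistUnitSupplyM` [XL; THE RESIDUAL, open
class-wide, per-pair decidable]. PROVED here: `upperOfTwistUnitM_of_print` (v1's sixth stub) and the composition
`MultLower_of`, which concludes the crux BY NAME.
-/

set_option autoImplicit false
set_option linter.dupNamespace false

namespace Summit.BirchSwinnertonDyer.BirchSwinnertonDyer.Cruxes.MultLower.TwistUnitRoadMult

open scoped Classical

open NumberField IsDedekindDomain
open WeierstrassCurve Literature.NumberTheory.EllipticCurves
  Literature.NumberTheory.EllipticCurves.ModularForms
  Literature.NumberTheory.EllipticCurves.Rank1Residual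
  Literature.NumberTheory.EllipticCurves.Rank1Residual.Typed

open Summit.BirchSwinnertonDyer.Rank1Residual
open Summit.BirchSwinnertonDyer.Rank1Residual.Additive
open Summit.BirchSwinnertonDyer.BirchSwinnertonDyer.Theses.AdditiveBranchIMC
open Summit.BirchSwinnertonDyer.BirchSwinnertonDyer.Theorems
open Summit.BirchSwinnertonDyer.BirchSwinnertonDyer.Theorems.SchneiderFree
/-! ### Vocabulary (defs, nothing asserted; `WanPrime`, `TameRoadRow`, `RoadRowM`, `TameRoadField`, `PrintedFactsM`
VERBATIM from the sibling line `tame_roads_mult` v4 — copied, not imported, so that this line does not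
depend on the sibling module's future rewrites; the copies are definitionally equal to the sibling's) -/

/-- The WAN PRIME (verbatim). [predicate; nothing asserted] -/
def WanPrime (W : WeierstrassCurve ℚ) [W.IsGloballyMinimal] (p q : ℕ) [Fact q.Prime] : Prop :=
  q ≠ p ∧ q ≠ 2 ∧ W.HasMultiplicativeReductionAtPrime q ∧ ¬ W.HasSplitMultiplicativeReductionAtPrime q ∧
    ¬ p ∣ padicValInt q W.minimalDiscriminantInt

/-- The tame sub-row (verbatim): `p ≥ 5`, `ρ̄` onto, `E` semistable outside `p`, a Wan prime.
[predicate; nothing asserted] -/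
def TameRoadRow (W : WeierstrassCurve ℚ) [W.IsGloballyMinimal] (p : ℕ) [Fact p.Prime] : Prop :=
  5 ≤ p ∧ Surj W p ∧
    (∀ ℓ : ℕ, (hℓ : ℓ.Prime) → ℓ ≠ p →
      (haveI : Fact ℓ.Prime := ⟨hℓ⟩;
        W.HasGoodReductionAtPrime ℓ ∨ W.HasMultiplicativeReductionAtPrime ℓ)) ∧
    ∃ q : ℕ, ∃ _ : Fact q.Prime, WanPrime W p q

/-- THE SUB-ROW OF THIS LINE (NEW): the tame sub-row, and in analytic rank `0` additionally `p ∤ ∏_ℓ c_ℓ(E)`.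
[predicate; nothing asserted] -/
def RoadRowM (W : WeierstrassCurve ℚ) [W.IsElliptic] [W.IsGloballyMinimal] (p : ℕ) [Fact p.Prime] : Prop :=
  TameRoadRow W p ∧ (W.analyticRank = 1 ∨ ¬ p ∣ W.tamagawaProduct)

/-- The TAME-ROAD FIELD (verbatim). [predicate; nothing asserted] -/
def TameRoadField (W : WeierstrassCurve ℚ) [W.IsGloballyMinimal] (p : ℕ)
    (K : Type) [Field K] [NumberField K] : Prop :=
  IsImaginaryQuadratic K ∧
    (∃ q : ℕ, ∃ _ : Fact q.Prime, WanPrime W p q ∧ (q : ℤ) ∣ NumberField.discr K ∧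
      ∀ ℓ : ℕ, ℓ.Prime → ℓ ∣ W.conductorNorm ℤ → ℓ ≠ q →
        ((Ideal.span {(ℓ : ℤ)}).primesOver (𝓞 K)).ncard = 2) ∧
    (¬ 2 ∣ W.conductorNorm ℤ → ((Ideal.span {(2 : ℤ)}).primesOver (𝓞 K)).ncard = 2) ∧
    SatisfiesHeegnerHypothesis p K

/-- The printed theorems the road consumes BY NAME (cite-only conjunction): Delbourgo 1998 Prop 4, GZK,
entire continuation, a modular parametrisation, Kato–Wuthrich half (the five inputs of the twist's rank-0
upper half, first, in this order); F5, F6 (Friedberg–Hoffstein with Castella–Wan local data, value resp.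
simple zero); parity; Cassels; Gross–Zagier I.(7.3); Skinner 2016 Thm C; Cai–Shu–Tian Thm 1.1 for the trivial
character AND for a ring class character (`thm11_ringClassChar`: the genus character of `K″`, `c = 1`); Voight
2007 Prop. 3.8 (`√d₁ ∈ H″`); Mazur 1978 Cor. 4.1 (`p` odd, `p² ∤ N_{E′}` ⟹ `p ∤ c`, here `p ∥ N_{E′}`); Hsieh
2014 Thm B (ramified Steinberg prime, any level at `p`); Liu–Zhang–Zhang Thm 1.5.1+1.5.3 (idem); Gross 2004 §2
(v3, LAST conjunct: the Artin factorisation `L(s, φ_{E′}, χ) = L(E′^{(d₁)}, s)·L(E′^{(d₂)}, s)` for a rational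
ring class character, `rankinLSeries_eq_mul_quadraticTwist`); v4: Hoffstein–Luo 1997, Theorem, for the newform of an
elliptic curve (F7 `HoffsteinLuo1997_exists_twist_L_one_ne_zero`: field 2's non-vanishing VALUE with prescribed
splitting, sign-agnostic — LAST conjunct, so every v3 projection `.1`, `.2.1`, …, `.2.….2.1` of the first
seventeen conjuncts is unchanged; only v3's last projection `….2` (Gross 2004) becomes `….2.1`). -/
def PrintedFactsM : Prop :=
  Delbourgo1998.prop4_rankZero_pow_dvd_constantCoeff ∧
    Literature.NumberTheory.EllipticCurves.rank_eq_analyticRank_of_analyticRank_le_one ∧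
    WeierstrassCurve.hasEntireLFunction_rat ∧
    Literature.NumberTheory.EllipticCurves.ModularForms.nonempty_modularParametrizationData ∧
    Wuthrich2014.kato_halfEigenCharIdeal_dvd_cyclotomicPrime_of_surjective ∧
    friedbergHoffstein_exists_twist_ne_zero_ramifiedAt_splitAt ∧
    friedbergHoffstein_exists_twist_simpleZero_ramifiedAt_splitAt ∧
    (∀ W : WeierstrassCurve ℚ,
      Literature.NumberTheory.EllipticCurves.even_analyticRank_iff_rootNumber_eq_one W) ∧
    WeierstrassCurve.bsdRHS_eq_of_isIsogenous ∧
    Literature.NumberTheory.EllipticCurves.GrossZagier1986_thm_I_7_3 ∧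
    Skinner2016.thmC_padicValRat_bsd_rank_zero ∧
    CaiShuTian2014.thm11_trivialChar ∧
    CaiShuTian2014.thm11_ringClassChar ∧
    Voight2007.prop38_sqrt_mem_ringClassField_iff ∧
    mazur_not_dvd_maninConstant_of_odd ∧
    Hsieh2014.thmB_exists_isHsiehLFunction_coeff_norm_eq_one_unrPeriod_ramifiedSteinberg ∧
    LiuZhangZhang2018.thm151_thm153_modularCurve_heegnerVector_additive_ramifiedSteinberg ∧
    Gross2004.rankinLSeries_eq_mul_quadraticTwist ∧
    Literature.NumberTheory.EllipticCurves.HoffsteinLuo1997_exists_twist_L_one_ne_zero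

/-- **TWIST-UNIT SUPPLY DATUM at `(Wd, p)`** (v2: the exact datum of the tree door
`HeegnerKolyvagin.missingUpperBoundAt_rankOne_istar_of_twistShaAnUnit`, member `Wd` ITSELF; VERBATIM the (G-ord)
twin's): an imaginary quadratic `K‴ = ℚ(√d)` satisfying the STRICT Heegner hypothesis for `N_{Wd}` (every prime
of the conductor split — so the additive prime `p` splits; `p² ∣ N_{Wd}` allowed), `L(Wd^{(d)}, 1) ≠ 0`, and a
globally minimal model `B` of `Wd^{(d)}` whose `#Ш_an` is a rational of non-positive `p`-adic valuation (`L ≠ 0`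
kept explicitly: the junk value `padicValRat p 0 = 0` must not count). Per pair a finite exact certificate.
v1's clauses `Odd d`, `d < −4` dropped (unused by the door). [cite: GrossZagier1986, Thm. I.(6.3)]
[cite: McCallumLMS1991, §1 Theorem (Kolyvagin), p. 296] -/
def TwistUnitSupplyDatum (Wd : WeierstrassCurve ℚ) [Wd.IsElliptic] (p : ℕ) [Fact p.Prime] : Prop :=
  ∃ (K : Type) (_ : Field K) (_ : NumberField K) (B : WeierstrassCurve ℚ) (_ : B.IsElliptic)
    (_ : B.IsGloballyMinimal),
    IsImaginaryQuadratic K ∧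
    SatisfiesHeegnerHypothesis (Wd.conductorNorm ℤ) K ∧
    (Wd.quadraticTwist (NumberField.discr K : ℚ)).entireLFunction 1 ≠ 0 ∧
    (∃ C : VariableChange ℚ, C • Wd.quadraticTwist (NumberField.discr K : ℚ) = B) ∧
    ∃ qd : ℚ, shaAn B = (qd : ℂ) ∧ padicValRat p qd ≤ 0

/-- The printed theorems this road consumes BY NAME: the sibling line's `PrintedFactsM` (Delbourgo, GZK,
Version L, a parametrisation, Wuthrich–Kato, F5, F6, parity, Cassels, GZ I.(7.3), Skinner 2016, CST ×2,
Voight, Mazur, Hsieh, LZZ, Gross 2004, Hoffstein–Luo — Skinner/CST-ring-class/Voight/Gross/Hoffstein–Luo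
are NOT used here) AND: Gross–Zagier ∀ (`gross_zagier`), Kolyvagin ∀
(`kolyvagin`: rank one and `Ш(E/K)` finite at a non-torsion Heegner point), Matar–Nekovář 2019 Thm 0.7
(irreducible form; unused in v2, kept for projection stability), Abbes–Ullmo and Česnavičius (Manin at primes
`∥ N` / at `2`, the inputs of the tree's `I_n*` Manin theorem), the newform of a parametrisation
(`exists_isNewformOf`), and — v2, LAST conjunct — Kolyvagin 1990 Thm A / McCallum 1991 §1, the `p`-EXACT bound
over a strict Heegner field, `p` odd, `ρ̄_{E,p}` onto (`Kolyvagin1990_padicValNat_card_sha_le`; a PUB input of the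
cell's Part 23b doors). LAST-conjunct convention as in v4 (projections of `PrintedFactsM` and of v1's
`PrintedFactsTUM` unchanged). [cite-only conjunction] [cite: McCallumLMS1991, §1 Theorem (Kolyvagin), p. 296] -/
def PrintedFactsTUM : Prop :=
  PrintedFactsM ∧
    (∀ (N : ℕ) [NeZero N] (W : WeierstrassCurve ℚ) (K : Type) [Field K] [NumberField K],
      gross_zagier N W K) ∧
    (∀ (N : ℕ) [NeZero N] (W : WeierstrassCurve ℚ) (K : Type) [Field K] [NumberField K],
      kolyvagin N W K) ∧
    MatarNekovar2019.thm07_padicValNat_card_sha_primary_add_le_of_globalDivisibility_of_irreducible ∧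
    abbesUllmo_not_dvd_maninConstant_of_not_dvd_level ∧
    cesnavicius_not_two_dvd_maninConstant_of_two_dvd_level ∧
    exists_isNewformOf ∧
    (∀ (N : ℕ) [NeZero N] (W : WeierstrassCurve ℚ) (K : Type) [Field K] [NumberField K],
      Kolyvagin1990_padicValNat_card_sha_le N W K)

/-! ### Registered stubs (the ONLY sorried declarations) -/

/-- stub (residualM) — VERBATIM `TameRoadsMult.stub_residualM` (shared; one proof closes both): the (M)
rows of analytic rank `≤ 1` OUTSIDE the sub-row (`p = 3`; `ρ̄` not onto, in particular the X3(M) rows; a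
second additive prime; no Wan prime; rank `0` with `p ∣ v_ℓ(Δ)` at a split multiplicative `ℓ`): the
route's children (19590 `MultLambdaLower`, 19591, …) remain the plan there. [XL, open-problem] -/
theorem stub_residualM :
    ∀ (W : WeierstrassCurve ℚ) [W.IsElliptic] [W.IsGloballyMinimal] (p : ℕ) [Fact p.Prime],
      W.analyticRank ≤ 1 → N10.CellM W p → ¬ RoadRowM W p → MissingLowerBoundAt W p := by
  sorry

/-- stub (printedFactsTUM) — cite-only (see `PrintedFactsTUM`). [cite-only] -/
theorem stub_printedFactsTUM : PrintedFactsTUM := by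
  sorry

/-- stub (fieldSupplyTUM) — FIELD 1 ONLY: on the sub-row in analytic rank `≤ 1`, a tame-road field `K`
and a globally minimal model `Wd` of `E^{(d_K)}` with `r_an(E) + r_an(Wd) = 1`, `Wd` again an (M) = X4(M)
pair at `p` with `ρ̄` onto, and `p ∤ ∏ c_ℓ(Wd)` whenever `p ∤ ∏ c_ℓ(E)`. = the first seven clauses of
`TameRoadsMult.stub_fieldSupplyM` (v4; stub-worker w2): F5/F6 by name at `V = E^{(p*)}_min`, parity + GZK
bookkeeping, cell / class / surjectivity / Tamagawa transport across the twist. A proof of w2's v4 stub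
proves this one by projection. [M] -/
theorem stub_fieldSupplyTUM : PrintedFactsM →
    ∀ (W : WeierstrassCurve ℚ) [W.IsElliptic] [W.IsGloballyMinimal] (p : ℕ) [Fact p.Prime],
      W.analyticRank ≤ 1 → N10.CellM W p → TameRoadRow W p →
        ∃ (K : Type) (_ : Field K) (_ : NumberField K)
          (Wd : WeierstrassCurve ℚ) (_ : Wd.IsElliptic) (_ : Wd.IsGloballyMinimal),
          TameRoadField W p K ∧
          (∃ C : WeierstrassCurve.VariableChange ℚ, C • W.quadraticTwist (NumberField.discr K : ℚ) = Wd) ∧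
          W.analyticRank + Wd.analyticRank = 1 ∧ N10.CellM Wd p ∧ AdditivePotMult.ClassX4M Wd p ∧
          Surj Wd p ∧ (¬ p ∣ W.tamagawaProduct → ¬ p ∣ Wd.tamagawaProduct) := by
  sorry

/-- stub (tameJointLowerM) — VERBATIM `TameRoadsMult.stub_tameJointLowerM` (shared; one proof closes
both): THE TAME ROAD on the (M) sub-row — at a tame-road field `K` with `r_an(E) + r_an(Wd) = 1` the JOINT
LOWER half `ord_p #Ш_an(E) + ord_p #Ш_an(Wd) ≤ ord_p #Ш(E) + ord_p #Ш(Wd)` (Wan 2015 Thm 1.1 (1) ∘ Hsieh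
Thm B ∘ PORT-1 ∘ LZZ ⟹ `BranchSocketAt`; CST Thm 1.1 + control ⟹ `TameStepLAt`; GZ bookkeeping).
[XL; the registered rank-one line's three stubs, symmetric in the ranks] -/
theorem stub_tameJointLowerM : PrintedFactsM →
    ∀ (W : WeierstrassCurve ℚ) [W.IsElliptic] [W.IsGloballyMinimal] (p : ℕ) [Fact p.Prime]
      (K : Type) [Field K] [NumberField K] (Wd : WeierstrassCurve ℚ) [Wd.IsElliptic] [Wd.IsGloballyMinimal],
      N10.CellM W p → TameRoadRow W p → TameRoadField W p K →
        (∃ C : WeierstrassCurve.VariableChange ℚ, C • W.quadraticTwist (NumberField.discr K : ℚ) = Wd) →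
        W.analyticRank + Wd.analyticRank = 1 → JointLowerBoundAt W Wd p := by
  sorry

/-- stub (twistUnitSupplyM) — THE RESIDUAL OF THIS LINE (its one non-printed input): every rank-one
potentially multiplicative curve `Wd` at `p ≥ 5` with `ρ̄_{Wd,p}` onto has a twist-unit supply datum — a
strict Heegner field `ℚ(√d)` for `N_{Wd}` (`d < −4` odd, all primes of `N_{Wd}` split) with
`L(Wd^{(d)},1) ≠ 0` and `ord_p #Ш_an(Wd^{(d)}_min) ≤ 0`. WHY PLAUSIBLE / WHY IT MIGHT FAIL / kill path:
as the (G-ord) twin — Ono–Skinner 1998 Cor. 2, 4 cover every `ℓ` outside an effectively determinable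
finite set but (L1)–(L2) (`ℓ ∤ 4N`, `ℓ > 2(k+2)`) exclude `ℓ = p ∣ N_{Wd}`; per pair a finite exact
certificate. [XL; open class-wide; cite: Ono–Skinner 1998 (doi:10.2307/121015, arXiv:math/9611225)
Cor. 2, Cor. 4, (L1)–(L2); Bruinier 1999 Thm 2; survey doi:10.1007/978-1-4613-0305-3_6 p. 7 Cor. 5] -/
theorem stub_twistUnitSupplyM :
    ∀ (Wd : WeierstrassCurve ℚ) [Wd.IsElliptic] [Wd.IsGloballyMinimal] (p : ℕ) [Fact p.Prime],
      5 ≤ p → Wd.analyticRank = 1 → N10.CellM Wd p → Surj Wd p →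
        TwistUnitSupplyDatum Wd p := by
  sorry

/-! ### The print port, PROVED (v1's `stub_upperOfTwistUnitM`; no sorry) -/

/-- **UPPER(`Wd`) at a potentially multiplicative prime from a twist-unit supply datum and PRINT BY NAME** —
the UPPER half `ord_p #Ш(Wd) ≤ ord_p #Ш_an(Wd)` of a rank-one (M) curve with `ρ̄_{Wd,p}` onto, `p ≥ 5`,
`p ∤ ∏ c_ℓ(Wd)`: the cell's tree theorem `HeegnerKolyvagin.missingUpperBoundAt_rankOne_istar_of_twistShaAnUnit`
(Part 23b §15; JSW 2017 §7.4.2 bookkeeping at `p² ∣ N` with Kolyvagin–McCallum's `p`-exact bound over the split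
strict Heegner field at a Manin-good Heegner datum, the twist's LOWER half free on its unit window), its Kodaira
input `Iₙ*` (`n ≥ 1`) at `p` supplied by
`ManinFrameResidueProperRTameTwist.exists_kodairaSymbolAt_eq_Istar_of_addv_of_padicValRat_j_neg` (additive with
`v_p(j) < 0` = cell (M)), fed with the conjuncts of `PrintedFactsTUM`. [cite: JetchevSkinnerWan2017, §7.4.2
(eq:shaupper), p. 31] [cite: McCallumLMS1991, §1 Theorem (Kolyvagin), p. 296] [cite: SilvermanATAEC1994, V.5.3 and
IV.9.4 Steps 6–7] [cite: Mazur1978, Cor. 4.1] [cite: AbbesUllmo1996, Thm. A] [cite: Cesnavicius2018, Thm. 1.2] -/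
theorem upperOfTwistUnitM_of_print : PrintedFactsTUM →
    ∀ (Wd : WeierstrassCurve ℚ) [Wd.IsElliptic] [Wd.IsGloballyMinimal] (p : ℕ) [Fact p.Prime],
      5 ≤ p → Wd.analyticRank = 1 → N10.CellM Wd p → Surj Wd p → ¬ p ∣ Wd.tamagawaProduct →
        TwistUnitSupplyDatum Wd p → MissingUpperBoundAt Wd p := by
  intro hF Wd _ _ p _ _ hr hc hs ht hTU
  obtain ⟨hM0, hGZ, hKo, -, hAU, hC2, hnf, hB⟩ := hF
  obtain ⟨-, hGZK, hmod, -, -, -, -, -, -, -, -, -, -, -, hMz, -⟩ := hM0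
  obtain ⟨K, iF, iNF, B, iB, iBm, hK, hH, hL, ⟨C, hC⟩, qd, hqd, hvd⟩ := hTU
  obtain ⟨hp2, hadd, hpm⟩ := hc
  have hgen : Rat.HeightOneSpectrum.natGenerator (placeOf p) = p :=
    congrArg Subtype.val ((Rat.HeightOneSpectrum.primesEquiv (R := ℤ)).apply_symm_apply ⟨p, Fact.out⟩)
  obtain ⟨n, hn⟩ :=
    ManinFrameResidueProperRTameTwist.exists_kodairaSymbolAt_eq_Istar_of_addv_of_padicValRat_j_neg
      Wd hp2 hadd hpm (placeOf p) hgen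
  exact AdditiveBranchIMCGordTwoRankOne.HeegnerKolyvagin.missingUpperBoundAt_rankOne_istar_of_twistShaAnUnit
    hGZ hKo hB hGZK hmod hnf hMz hAU hC2 Wd p K B C hr hp2 hadd ⟨placeOf p, n, hgen, hn⟩ hs ht hK hH hL hC
    hqd hvd

/-! ### The composition (kernel-checked, no sorry of its own) -/

/-- THE SKELETON: the crux `MultLower` BY NAME from exactly the five registered stubs — by cases on «the
curve lies on the sub-row»; on it, field 1 gives `(K, Wd)` and the joint lower half; in analytic rank `0`
the supply gives the rank-one twist a twist-unit datum and the PROVED print port `upperOfTwistUnitM_of_print` its UPPER half; in analytic rank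
`1` the twist has rank `0` and its upper half is the tree theorem
`AdditivePotMult.ClassX4M.missingUpperBoundAt_rankZero_of_surj_noL20`; `missingLowerBoundAt_of_joint_of_upper`
finishes; off the sub-row, the residual stub. -/
theorem MultLower_of : MultLower := by
  intro W _ _ p _ hr hcell
  by_cases hs : RoadRowM W p
  · obtain ⟨hs1, hs2⟩ := hs
    have hF0 : PrintedFactsM := stub_printedFactsTUM.1
    obtain ⟨K, iF, iNF, Wd, iWd, iWdm, hK, htw, hsum, hcelld, hXd, hsurjd, htamd⟩ :=
      stub_fieldSupplyTUM hF0 W p hr hcell hs1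
    have hJ : JointLowerBoundAt W Wd p :=
      stub_tameJointLowerM hF0 W p K Wd hcell hs1 hK htw hsum
    rcases Nat.le_one_iff_eq_zero_or_eq_one.mp hr with hr0 | hr1
    · -- analytic rank 0: the twist-unit road for the rank-one twist
      have ht : ¬ p ∣ W.tamagawaProduct := hs2.resolve_left (by omega)
      have hrd : Wd.analyticRank = 1 := by omega
      have h5 : 5 ≤ p := hs1.1
      have hTU : TwistUnitSupplyDatum Wd p := stub_twistUnitSupplyM Wd p h5 hrd hcelld hsurjd
      have hU : MissingUpperBoundAt Wd p :=
        upperOfTwistUnitM_of_print stub_printedFactsTUM Wd p h5 hrd hcelld hsurjd (htamd ht) hTU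
      exact missingLowerBoundAt_of_joint_of_upper hJ hU
    · -- analytic rank 1: the tame road, twist's upper half from the tree
      have hrd : Wd.analyticRank = 0 := by omega
      obtain ⟨hDel, hGZK, hmod, hmodD, hKato, -⟩ := hF0
      exact missingLowerBoundAt_of_joint_of_upper hJ
        (AdditivePotMult.ClassX4M.missingUpperBoundAt_rankZero_of_surj_noL20 hDel hGZK hmod hmodD hKato
          hXd hrd hsurjd)
  · exact stub_residualM W p hr hcell hs

end Summit.BirchSwinnertonDyer.BirchSwinnertonDyer.Cruxes.MultLower.TwistUnitRoadMult
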